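/-
Copyright (c) 2026 the pub-hodgecm-mathlib formalisation cell (harness21).  Prover seat hodgecm-mathlib-LH4-p04 (g2), req620 Track A «(D-RAM) FOUR-FRAME» squad
(MS ROAD A, STAGE B brick B3₂ «TYPE-2 STRATA TABLE» — part 6b: THE SIEVED TABLE in HNF∕valuation currency).  2026-09-04.
-/
import Summits.HodgeConjecture.HodgeConjecture.Theorems.F0P3cDyRamDiagonalHNFDualFrameValuesTypeTwo   -- ★ part 5 (this seat): `dualFrame_sandwich`, `gram_values_of_type`; brings ★ part 1, ★ TorusDefs, ★ HNF
import Summits.HodgeConjecture.HodgeConjecture.Theorems.F0P3cDyRamDiagonalTypeTwoSieveInt              -- ★ part 6a (this seat): `typeTwo_sieve_int`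
import HarnessLib

/-!
# Crux `H413`, line LH4 «(D-RAM) FOUR-FRAME» road — unit U3_Laws (iii), MS ROAD A, STAGE B brick B3₂ (part 6b): THE SIEVED TYPE-2 TABLE — a normalised HNF lattice
# `(1 0 0; x ϖ^b 0; y z ϖ^c)·𝒪³` that is a TYPE-2 vertex for some `σ`-fixed diagonal form lies in one of the ten genuine type-2 strata or in one of eleven residual families

Cell `hodgecm-mathlib` (D-0151), FLOOR 0, crux item H413 = `stmt-HodgeConjecture-24833`, route of record `HCCMUnconditional`; squad F0∕P3c∕LH4 (req618∕req620); registered stub served: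
`F0P3cDyRamFourFrameU3.stub_U3_stableModelSum` (MS).  THEOREMS ONLY (no `def`, no instance, no notation, no `sorry`, default heartbeats); lane
`--supports stmt-HodgeConjecture-24833 --as helper` (count-neutral).  STAGE B type-2 twin (LH4-p10 (g2) `MEMO-stableLaw-finite.v2.1-type2` §T2.1, B10₂ skeleton; this seat's
census `F0/P3c/LH4/LH4-p04/g2/CENSUS-B3type2.v1.LH4p04g2.md`).  The residual families X1–X11 are NOT type-2 polarisable (oracle: weight `0`), but die only on the Gram ∕ dual-Gram
ENTRIES — one small brick each, with the exact signatures fixed by the disjuncts below; for `b = 0` and for `c = 0` the list is already the genuine one.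

THE MATHEMATICS.  ★ part 5 gives `|ϖ|·R_i ≤ |D_i| ≤ R_i` and `|det G| = |ϖ|²`; `hfix` makes `|D_i| = exp(2f_i)` an even power; with `m = v z`, `w = v(xz − yϖ^b)` (capped when the element
vanishes) this is the integer input of ★ part 6a `typeTwo_sieve_int` — the sandwich `a_i − 1 ≤ 2f_i ≤ a_i` (`a₀ = max(b, b+c−w)`, `a₁ = max(b, b+c−m)`, `a₂ = c`), the determinant
`f₀ + f₁ + f₂ = b + c − 1`, and the ultrametric relations (R1)–(R4) between `w`, `m`, `b` (normalisation: `|x| = 1` if `b ≥ 1`; `|y| = 1` or `|z| = 1` if `c ≥ 1`).  The conclusion is read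
back in valuation currency (`m = k ↦ |z| = |ϖ^k|`, `c ≤ m ↦ |z| ≤ |ϖ^c|`, same for `w`), with `|y| = 1` recorded wherever `|z| < 1`.

WHAT IS PROVED.  HEAD `typeTwo_sieve` — the 21-way table (T₃ odd; T₁, G₁(1,·), H(1), T₂, G₂(1,·); G₁, H, G₂, G₃; X1–X11) for a normalised type-2-polarisable HNF lattice.
HONEST LABEL.  Count-neutral (`--supports`); nothing printed is asserted; (MS) stays a PROVER TARGET (empirical census law — MEMO v2∕v2.1 is its paper proof); `HC_CM` is proved only
modulo the 7 printed citations (2 remaining named inputs: hLiu418 = `stmt-HodgeConjecture-24832`, h413 = `stmt-HodgeConjecture-24833`) until rung 0 closes.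

## References
* [Jacobowitz1962] R. Jacobowitz, *Hermitian forms over local fields*, Amer. J. Math. 84 (1962), §7–§8 (`𝔭`-modular lattices, determinant type).
* [Kottwitz1986BaseChangeUnits] R. E. Kottwitz, *Base change for unit elements of Hecke algebras*, Compositio Math. 60 (1986), §1 pp. 240–241 (fixed lattices counted by position).
* [Serre1980Trees] J.-P. Serre, *Trees*, Springer (1980), Ch. II §1.1 (Hermite normal forms, coordinate axes).
-/

set_option autoImplicit false

noncomputable section

namespace Summit.HodgeConjecture.HodgeConjecture.Cruxes.H413.F0P3cDyRamDiagonalDualisableStrataTypeTwoSieve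

open Matrix
open Literature.NumberTheory.Automorphic Literature.NumberTheory.Automorphic.HermitianLattice
open Literature.NumberTheory.Automorphic.UnitaryLatticeTree
open Summit.HodgeConjecture.HodgeConjecture.Cruxes.H413.F0P3cDyRamDiagonalTorusDefs
open Summit.HodgeConjecture.HodgeConjecture.Cruxes.H413.F0P3cDyRamDiagonalStableLatticeHNF
open Summit.HodgeConjecture.HodgeConjecture.Cruxes.H413.F0P3cDyRamDiagonalHNFDualFrameValuesTypeTwo
open Summit.HodgeConjecture.HodgeConjecture.Cruxes.H413.F0P3cDyRamDiagonalTypeTwoSieveInt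
open scoped Valued WithZero Matrix MatrixGroups

variable {K : Type*} [Field K] [Valued K ℤᵐ⁰]

/-- **AN INTEGRAL ELEMENT HAS A NATURAL EXPONENT, OR VANISHES (capped)**: for `|u| ≤ 1` and any cap `C` there is `m : ℕ` with (`u ≠ 0 → |u| = |ϖ^m|`) and (`u = 0 → m = C`).
[cite: Serre1980Trees, II §1.1] -/
theorem exists_exponent_or_cap {ϖ : K} (hϖ : Valued.v ϖ = WithZero.exp (-1 : ℤ)) {u : K} (hu : Valued.v u ≤ 1) (C : ℕ) :
    ∃ m : ℕ, (u ≠ 0 → Valued.v u = Valued.v (ϖ ^ m)) ∧ (u = 0 → m = C) := by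
  by_cases hu0 : u = 0
  · exact ⟨C, fun h => absurd hu0 h, fun _ => rfl⟩
  obtain ⟨k, hk⟩ : ∃ k : ℤ, Valued.v u = WithZero.exp k :=
    ⟨WithZero.log (Valued.v u), (WithZero.exp_log ((Valuation.ne_zero_iff _).2 hu0)).symm⟩
  have hk0 : k ≤ 0 := by rw [hk, ← WithZero.exp_zero, WithZero.exp_le_exp] at hu; exact hu
  refine ⟨k.natAbs, fun _ => ?_, fun h => absurd h hu0⟩
  rw [hk, map_pow, hϖ, ← WithZero.exp_nsmul, WithZero.exp_inj, smul_neg, nsmul_eq_mul, mul_one]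
  omega

/-- **B3₂ · THE SIEVED TYPE-2 TABLE** (census §1; part 6a in valuation currency).  Let `σ` preserve the valuation with even valuations on its non-zero fixed points, `|ϖ| = exp(−1)`,
`x y z ∈ 𝒪`, and let the HNF lattice `M = (1 0 0; x ϖ^b 0; y z ϖ^c)·𝒪³` be NORMALISED and a TYPE-2 VERTEX for some `σ`-fixed non-degenerate diagonal form.  Then one of: the genuine
type-2 strata T₃ (`c = 0`, `b` odd) · T₁ · G₁(1, c−1) · H(1) · T₂ · G₂(1, c−1) (`b = 0`, `c` odd) · G₁ · H · G₂ · G₃ (`b ≥ 1`) — or a residual family X1–X11 (to be excluded entry-wise).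
[cite: Jacobowitz1962, §7–§8] [cite: Kottwitz1986BaseChangeUnits, §1 pp. 240–241] [cite: Serre1980Trees, II §1.1] -/
theorem typeTwo_sieve {σ : K →+* K} (hvσ : ∀ a, Valued.v (σ a) = Valued.v a)
    (hfix : ∀ t : K, σ t = t → t ≠ 0 → ∃ n : ℤ, Valued.v t = WithZero.exp (2 * n))
    {ϖ : K} (hϖ : Valued.v ϖ = WithZero.exp (-1 : ℤ)) (b c : ℕ) {x y z : K}
    (hx : Valued.v x ≤ 1) (hy : Valued.v y ≤ 1) (hz : Valued.v z ≤ 1)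
    (hn : IsNormalisedLattice (latt (Matrix.of ![![1, 0, 0], ![x, ϖ ^ b, 0], ![y, z, ϖ ^ c]])))
    (hpol : ∃ D : Fin 3 → K, (∀ i, σ (D i) = D i ∧ D i ≠ 0) ∧ IsVertexLattice σ ϖ (Matrix.diagonal D) 2 (latt (Matrix.of ![![1, 0, 0], ![x, ϖ ^ b, 0], ![y, z, ϖ ^ c]]))) :
    -- genuine, `c = 0`
    (c = 0 ∧ b % 2 = 1) ∨
    -- genuine, `b = 0`
    (b = 0 ∧ c % 2 = 1 ∧ Valued.v z = 1 ∧ Valued.v (x * z - y * ϖ ^ b) ≤ Valued.v (ϖ ^ c)) ∨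
    (b = 0 ∧ c % 2 = 1 ∧ 3 ≤ c ∧ Valued.v z = 1 ∧ Valued.v (x * z - y * ϖ ^ b) = Valued.v (ϖ ^ (c - 1))) ∨
    (b = 0 ∧ c = 1 ∧ Valued.v z = 1 ∧ Valued.v (x * z - y * ϖ ^ b) = 1) ∨
    (b = 0 ∧ c % 2 = 1 ∧ Valued.v z ≤ Valued.v (ϖ ^ c) ∧ Valued.v y = 1) ∨
    (b = 0 ∧ c % 2 = 1 ∧ 3 ≤ c ∧ Valued.v z = Valued.v (ϖ ^ (c - 1)) ∧ Valued.v y = 1) ∨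
    -- genuine, `b ≥ 1`: G₁, H, G₂, G₃
    (1 ≤ b ∧ c % 2 = 1 ∧ 2 * b + 3 ≤ c ∧ Valued.v z = Valued.v (ϖ ^ b) ∧ Valued.v y = 1 ∧ Valued.v (x * z - y * ϖ ^ b) = Valued.v (ϖ ^ (c - b - 1))) ∨
    (1 ≤ b ∧ c = 2 * b + 1 ∧ Valued.v z = Valued.v (ϖ ^ b) ∧ Valued.v y = 1 ∧ Valued.v (x * z - y * ϖ ^ b) = Valued.v (ϖ ^ b)) ∨
    (1 ≤ b ∧ c % 2 = 1 ∧ 2 * b + 3 ≤ c ∧ Valued.v z = Valued.v (ϖ ^ (c - b - 1)) ∧ Valued.v y = 1) ∨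
    (∃ m : ℕ, m < b ∧ c = 2 * m + 1 ∧ (b + m) % 2 = 0 ∧ Valued.v z = Valued.v (ϖ ^ m) ∧ (1 ≤ m → Valued.v y = 1)) ∨
    -- residual X1–X5
    (2 ≤ b ∧ b % 2 = 0 ∧ (c = 1 ∨ c = 2) ∧ Valued.v z ≤ Valued.v (ϖ ^ c) ∧ Valued.v y = 1 ∧ Valued.v (x * z - y * ϖ ^ b) ≤ Valued.v (ϖ ^ c)) ∨
    ((b = 1 ∨ b = 2) ∧ c % 2 = 0 ∧ 2 * b ≤ c ∧ Valued.v z ≤ Valued.v (ϖ ^ c) ∧ Valued.v y = 1 ∧ Valued.v (x * z - y * ϖ ^ b) = Valued.v (ϖ ^ b)) ∨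
    (1 ≤ b ∧ c % 2 = 1 ∧ 2 * b < c ∧ Valued.v z = Valued.v (ϖ ^ (c - b)) ∧ Valued.v y = 1) ∨
    (2 ≤ b ∧ c % 2 = 0 ∧ 2 * b ≤ c ∧ Valued.v z = Valued.v (ϖ ^ (c - b + 1)) ∧ Valued.v y = 1) ∨
    (3 ≤ b ∧ c % 2 = 0 ∧ 2 * b ≤ c ∧ Valued.v z = Valued.v (ϖ ^ (c - b + 2)) ∧ Valued.v y = 1) ∨
    -- residual X6–X8
    (∃ m : ℕ, 2 ≤ m ∧ m < b ∧ c = 2 * m - 1 ∧ (b + m) % 2 = 1 ∧ Valued.v z = Valued.v (ϖ ^ m) ∧ Valued.v y = 1) ∨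
    (∃ m : ℕ, 1 ≤ m ∧ m < b ∧ c = 2 * m ∧ (b + m) % 2 = 1 ∧ Valued.v z = Valued.v (ϖ ^ m) ∧ Valued.v y = 1) ∨
    (∃ m : ℕ, 3 ≤ m ∧ m < b ∧ c = 2 * m - 2 ∧ (b + m) % 2 = 0 ∧ Valued.v z = Valued.v (ϖ ^ m) ∧ Valued.v y = 1) ∨
    -- residual X9–X11
    (1 ≤ b ∧ c % 2 = 1 ∧ 2 * b + 1 ≤ c ∧ Valued.v z = Valued.v (ϖ ^ b) ∧ Valued.v y = 1 ∧ Valued.v (x * z - y * ϖ ^ b) = Valued.v (ϖ ^ (c - b))) ∨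
    (1 ≤ b ∧ c % 2 = 0 ∧ b < c ∧ Valued.v z = Valued.v (ϖ ^ b) ∧ Valued.v y = 1 ∧
      ((b = 1 ∧ Valued.v (x * z - y * ϖ ^ b) ≤ Valued.v (ϖ ^ c)) ∨ (2 ≤ b ∧ 2 * b ≤ c ∧ Valued.v (x * z - y * ϖ ^ b) = Valued.v (ϖ ^ (c - b + 1))))) ∨
    (2 ≤ b ∧ c % 2 = 0 ∧ b < c ∧ Valued.v z = Valued.v (ϖ ^ b) ∧ Valued.v y = 1 ∧
      ((b = 2 ∧ Valued.v (x * z - y * ϖ ^ b) ≤ Valued.v (ϖ ^ c)) ∨ (3 ≤ b ∧ 2 * b - 2 ≤ c ∧ Valued.v (x * z - y * ϖ ^ b) = Valued.v (ϖ ^ (c - b + 2))))) := by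
  -- ### the polarising form, its even valuations, the sandwich and the determinant
  obtain ⟨D, hDfix, hM⟩ := hpol
  have hD0 : ∀ i, D i ≠ 0 := fun i => (hDfix i).2
  have hϖ0 : ϖ ≠ 0 := (Valuation.ne_zero_iff Valued.v).1 (by rw [hϖ]; exact WithZero.exp_ne_zero)
  obtain ⟨e₀, he₀⟩ := hfix (D 0) (hDfix 0).1 (hD0 0)
  obtain ⟨e₁, he₁⟩ := hfix (D 1) (hDfix 1).1 (hD0 1)
  obtain ⟨e₂, he₂⟩ := hfix (D 2) (hDfix 2).1 (hD0 2)
  obtain ⟨⟨hA2l, hA2u⟩, ⟨hA1b, hA1z, hA1eq⟩, ⟨hA0one, hA0x, hA0w, hA0eq⟩⟩ := dualFrame_sandwich hvσ hϖ hD0 b c hn hM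
  obtain ⟨-, -, -, hdetG⟩ := gram_values_of_type hvσ hϖ0 D b c x y z hM
  have hq : ∀ n : ℕ, Valued.v (ϖ ^ n) = WithZero.exp (-(n : ℤ)) := fun n => by
    rw [map_pow, hϖ, ← WithZero.exp_nsmul]
    congr 1
    simp
  have hq1 : ∀ n : ℕ, Valued.v (ϖ ^ n) ≤ 1 := fun n => by
    rw [hq, ← WithZero.exp_zero, WithZero.exp_le_exp]; omega
  have hq_eq_one : ∀ n : ℕ, Valued.v (ϖ ^ n) = 1 → n = 0 := fun n h => by
    rw [hq, ← WithZero.exp_zero, WithZero.exp_inj] at h; omega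
  have hN := (normalised_latt_hnf_iff hx hy hz (hq1 b) (hq1 c)).1 hn
  -- determinant: `e₀ + e₁ + e₂ = b + c − 1`
  have hdet : e₀ + e₁ + e₂ = (b : ℤ) + c - 1 := by
    simp only [map_mul, map_pow, hvσ, hϖ, he₀, he₁, he₂, ← WithZero.exp_nsmul, ← WithZero.exp_add, nsmul_eq_mul, mul_neg, mul_one] at hdetG
    rw [WithZero.exp_inj] at hdetG
    omega
  -- ### the exponents `m = v z`, `w = v(xz − yϖ^b)` (capped at `b + c + 3` when the element vanishes)
  have ht1 : Valued.v (x * z - y * ϖ ^ b) ≤ 1 :=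
    Valuation.map_sub_le _ (by rw [map_mul]; exact mul_le_one' hx hz) (by rw [map_mul]; exact mul_le_one' hy (hq1 b))
  obtain ⟨m, hm1, hm2⟩ := exists_exponent_or_cap hϖ hz (b + c + 3)
  obtain ⟨w, hw1, hw2⟩ := exists_exponent_or_cap hϖ ht1 (b + c + 3)
  -- translation helpers
  have hzm : ∀ k : ℕ, m = k → k ≤ c + 2 → Valued.v z = Valued.v (ϖ ^ k) := fun k hk hkc => by
    by_cases hz0 : z = 0
    · have := hm2 hz0; omega
    · rw [hm1 hz0, hk]
  have hzle : c ≤ m → Valued.v z ≤ Valued.v (ϖ ^ c) := fun hcm => by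
    by_cases hz0 : z = 0
    · rw [hz0, map_zero]; exact zero_le
    · rw [hm1 hz0, hq, hq, WithZero.exp_le_exp]; omega
  have hwm : ∀ k : ℕ, w = k → k ≤ c + 2 → Valued.v (x * z - y * ϖ ^ b) = Valued.v (ϖ ^ k) := fun k hk hkc => by
    by_cases ht0 : x * z - y * ϖ ^ b = 0
    · have := hw2 ht0; omega
    · rw [hw1 ht0, hk]
  have hwle : c ≤ w → Valued.v (x * z - y * ϖ ^ b) ≤ Valued.v (ϖ ^ c) := fun hcw => by
    by_cases ht0 : x * z - y * ϖ ^ b = 0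
    · rw [ht0, map_zero]; exact zero_le
    · rw [hw1 ht0, hq, hq, WithZero.exp_le_exp]; omega
  -- `|y| = 1` whenever `c ≥ 1` and `|z| < 1`
  have hy1 : 1 ≤ c → 1 ≤ m → Valued.v y = 1 := fun hc1 hm => by
    rcases hN.2 with h | h | h
    · exact absurd (hq_eq_one c h) (by omega)
    · exact h
    · exfalso
      by_cases hz0 : z = 0
      · rw [hz0, map_zero] at h; exact zero_ne_one h
      · rw [hm1 hz0, hq, ← WithZero.exp_zero, WithZero.exp_inj] at h; omega
  -- `|x| = 1` whenever `b ≥ 1`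
  have hx1 : 1 ≤ b → Valued.v x = 1 := fun hb =>
    hN.1.resolve_left fun h => by have := hq_eq_one b h; omega
  -- ### the integer hypotheses of the sieve
  -- slot 2
  have hS2l : (c : ℤ) - 1 ≤ 2 * e₂ := by
    rw [he₂, hϖ, ← WithZero.exp_add, WithZero.exp_le_exp] at hA2l; omega
  have hS2u : 2 * e₂ ≤ (c : ℤ) := by
    rw [he₂, WithZero.exp_le_exp] at hA2u; exact hA2u
  -- slot 1
  have hS1b : (b : ℤ) - 1 ≤ 2 * e₁ := by
    rw [he₁, hϖ, ← WithZero.exp_add, WithZero.exp_le_exp] at hA1b; omega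
  have hS1z : z ≠ 0 → (b : ℤ) + c - m - 1 ≤ 2 * e₁ := fun hz0 => by
    have h := hA1z
    rw [he₁, hϖ, hm1 hz0, hq, ← WithZero.exp_add, ← WithZero.exp_add, WithZero.exp_le_exp] at h
    omega
  have hS1l : max (b : ℤ) (b + c - m) - 1 ≤ 2 * e₁ := by
    by_cases hz0 : z = 0
    · have := hm2 hz0; omega
    · have := hS1z hz0; omega
  have hS1u : 2 * e₁ ≤ max (b : ℤ) (b + c - m) := by
    rcases hA1eq with h | h
    · rw [he₁, WithZero.exp_le_exp] at h; exact h.trans (le_max_left _ _)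
    · by_cases hz0 : z = 0
      · rw [hz0, map_zero, zero_mul, he₁] at h
        exact absurd (le_antisymm h zero_le) WithZero.exp_ne_zero
      · rw [he₁, hm1 hz0, hq, ← WithZero.exp_add, WithZero.exp_le_exp] at h
        exact le_max_of_le_right (by omega)
  -- slot 0
  have hS0one : (-1 : ℤ) ≤ 2 * e₀ := by
    rw [he₀, hϖ, WithZero.exp_le_exp] at hA0one; omega
  have hS0b : 1 ≤ b → (b : ℤ) - 1 ≤ 2 * e₀ := fun hb => by
    have h := hA0x
    rw [he₀, hϖ, hx1 hb, one_mul, ← WithZero.exp_add, WithZero.exp_le_exp] at h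
    omega
  have hS0w : x * z - y * ϖ ^ b ≠ 0 → (b : ℤ) + c - w - 1 ≤ 2 * e₀ := fun ht0 => by
    have h := hA0w
    rw [he₀, hϖ, hw1 ht0, hq, ← WithZero.exp_add, ← WithZero.exp_add, WithZero.exp_le_exp] at h
    omega
  have hS0l : max (b : ℤ) (b + c - w) - 1 ≤ 2 * e₀ := by
    have hbb : (b : ℤ) - 1 ≤ 2 * e₀ := by
      rcases Nat.eq_zero_or_pos b with hb | hb
      · subst hb; simpa using hS0one
      · exact hS0b hb
    by_cases ht0 : x * z - y * ϖ ^ b = 0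
    · have := hw2 ht0; omega
    · have := hS0w ht0; omega
  have hS0u : 2 * e₀ ≤ max (b : ℤ) (b + c - w) := by
    rcases hA0eq with h | h | h
    · rw [he₀, ← WithZero.exp_zero, WithZero.exp_le_exp] at h
      exact le_max_of_le_left (by omega)
    · have h' : Valued.v (D 0) ≤ WithZero.exp (b : ℤ) := h.trans (mul_le_of_le_one_left' hx)
      rw [he₀, WithZero.exp_le_exp] at h'
      exact le_max_of_le_left h'
    · by_cases ht0 : x * z - y * ϖ ^ b = 0
      · rw [ht0, map_zero, zero_mul, he₀] at h
        exact absurd (le_antisymm h zero_le) WithZero.exp_ne_zero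
      · rw [he₀, hw1 ht0, hq, ← WithZero.exp_add, WithZero.exp_le_exp] at h
        exact le_max_of_le_right (by omega)
  -- ### the relations (R1)–(R4)
  have hvxz : z ≠ 0 → 1 ≤ b → Valued.v (x * z) = WithZero.exp (-(m : ℤ)) := fun hz0 hb => by
    rw [map_mul, hx1 hb, one_mul, hm1 hz0, hq]
  have hvyb : Valued.v (y * ϖ ^ b) ≤ WithZero.exp (-(b : ℤ)) := by
    rw [map_mul, hq]; exact mul_le_of_le_one_left' hy
  have R1 : b = 0 → 1 ≤ c → 1 ≤ m → w = 0 := fun hb hc hm => by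
    subst hb
    have hyv : Valued.v y = 1 := hy1 hc hm
    have hzlt : Valued.v (x * z) < 1 := by
      by_cases hz0 : z = 0
      · rw [hz0, mul_zero, map_zero]; exact zero_lt_one
      · rw [map_mul, hm1 hz0, hq]
        calc Valued.v x * WithZero.exp (-(m : ℤ)) ≤ 1 * WithZero.exp (-(m : ℤ)) := mul_le_mul' hx le_rfl
          _ < 1 := by rw [one_mul, ← WithZero.exp_zero, WithZero.exp_lt_exp]; omega
    have ht : Valued.v (x * z - y * ϖ ^ 0) = 1 := by
      rw [pow_zero, mul_one, Valuation.map_sub_eq_of_lt_right _ (by rw [hyv]; exact hzlt)]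
      exact hyv
    have ht0 : x * z - y * ϖ ^ 0 ≠ 0 := fun h => by rw [h, map_zero] at ht; exact zero_ne_one ht
    have := hw1 ht0
    rw [ht, hq, ← WithZero.exp_zero, WithZero.exp_inj] at this
    omega
  have R2 : 1 ≤ b → 1 ≤ c → b < m → w = b := fun hb hc hbm => by
    have hyv : Valued.v y = 1 := hy1 hc (by omega)
    have hlt : Valued.v (x * z) < Valued.v (y * ϖ ^ b) := by
      rw [map_mul Valued.v y, hyv, one_mul, hq]
      by_cases hz0 : z = 0
      · rw [hz0, mul_zero, map_zero]; exact WithZero.exp_pos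
      · rw [hvxz hz0 hb, WithZero.exp_lt_exp]; omega
    have ht : Valued.v (x * z - y * ϖ ^ b) = WithZero.exp (-(b : ℤ)) := by
      rw [Valuation.map_sub_eq_of_lt_right _ hlt, map_mul, hyv, one_mul, hq]
    have ht0 : x * z - y * ϖ ^ b ≠ 0 := fun h => by rw [h, map_zero] at ht; exact WithZero.exp_ne_zero ht.symm
    have := hw1 ht0
    rw [ht, hq, WithZero.exp_inj] at this
    omega
  have R3 : 1 ≤ b → m < b → w = m := fun hb hmb => by
    have hz0 : z ≠ 0 := fun h => by have := hm2 h; omega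
    have hlt : Valued.v (y * ϖ ^ b) < Valued.v (x * z) := by
      rw [hvxz hz0 hb]
      exact lt_of_le_of_lt hvyb (by rw [WithZero.exp_lt_exp]; omega)
    have ht : Valued.v (x * z - y * ϖ ^ b) = WithZero.exp (-(m : ℤ)) := by
      rw [Valuation.map_sub_eq_of_lt_left _ hlt, hvxz hz0 hb]
    have ht0 : x * z - y * ϖ ^ b ≠ 0 := fun h => by rw [h, map_zero] at ht; exact WithZero.exp_ne_zero ht.symm
    have := hw1 ht0
    rw [ht, hq, WithZero.exp_inj] at this
    omega
  have R4 : 1 ≤ b → m = b → b ≤ w := fun hb hmb => by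
    have hz0 : z ≠ 0 := fun h => by have := hm2 h; omega
    by_cases ht0 : x * z - y * ϖ ^ b = 0
    · have := hw2 ht0; omega
    · have hle : Valued.v (x * z - y * ϖ ^ b) ≤ WithZero.exp (-(b : ℤ)) :=
        Valuation.map_sub_le _ (by rw [hvxz hz0 hb, WithZero.exp_le_exp]; omega) hvyb
      rw [hw1 ht0, hq, WithZero.exp_le_exp] at hle
      omega
  -- ### the sieve, read back
  have key := typeTwo_sieve_int b c m w e₀ e₁ e₂ hS0l hS0u hS1l hS1u hS2l hS2u hdet R1 R2 R3 R4
  rcases key with ⟨hc, hb⟩ | ⟨hb, hc, hm, hw⟩ | ⟨hb, hc, hc3, hm, hw⟩ | ⟨hb, hc, hm, hw⟩ | ⟨hb, hc, hm⟩ | ⟨hb, hc, hc3, hm⟩ |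
      ⟨hb, hm, hc, hcb, hw⟩ | ⟨hb, hm, hc, hw⟩ | ⟨hb, hc, hcb, hm⟩ | ⟨hb, hmb, hc, hp⟩ |
      ⟨hb, hp, hc, hm, hw⟩ | ⟨hb, hc, hcb, hm, hw⟩ | ⟨hb, hc, hcb, hm, hw⟩ | ⟨hb, hc, hcb, hm, hw⟩ | ⟨hb, hc, hcb, hm, hw⟩ |
      ⟨hm2', hmb, hc, hp, hw⟩ | ⟨hm1', hmb, hc, hp, hw⟩ | ⟨hm3, hmb, hc, hp, hw⟩ |
      ⟨hb, hm, hc, hcb, hw⟩ | ⟨hb, hm, hc, hcb, hw⟩ | ⟨hb, hm, hc, hcb, hw⟩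
  · exact Or.inl ⟨hc, hb⟩
  · refine Or.inr (Or.inl ⟨hb, hc, ?_, hwle hw⟩)
    have := hzm 0 hm (by omega); rwa [pow_zero, map_one] at this
  · refine Or.inr (Or.inr (Or.inl ⟨hb, hc, hc3, ?_, hwm _ hw (by omega)⟩))
    have := hzm 0 hm (by omega); rwa [pow_zero, map_one] at this
  · refine Or.inr (Or.inr (Or.inr (Or.inl ⟨hb, hc, ?_, ?_⟩)))
    · have := hzm 0 hm (by omega); rwa [pow_zero, map_one] at this
    · have := hwm 0 hw (by omega); rwa [pow_zero, map_one] at this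
  · exact Or.inr (Or.inr (Or.inr (Or.inr (Or.inl ⟨hb, hc, hzle hm, hy1 (by omega) (by omega)⟩))))
  · exact Or.inr (Or.inr (Or.inr (Or.inr (Or.inr (Or.inl ⟨hb, hc, hc3, hzm _ hm (by omega), hy1 (by omega) (by omega)⟩)))))
  · refine Or.inr (Or.inr (Or.inr (Or.inr (Or.inr (Or.inr (Or.inl ⟨hb, hc, hcb, hzm _ hm (by omega), hy1 (by omega) (by omega), hwm _ hw (by omega)⟩))))))
  · refine Or.inr (Or.inr (Or.inr (Or.inr (Or.inr (Or.inr (Or.inr (Or.inl ⟨hb, hc, hzm _ hm (by omega), hy1 (by omega) (by omega), hwm _ hw (by omega)⟩)))))))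
  · refine Or.inr (Or.inr (Or.inr (Or.inr (Or.inr (Or.inr (Or.inr (Or.inr (Or.inl ⟨hb, hc, hcb, hzm _ hm (by omega), hy1 (by omega) (by omega)⟩))))))))
  · refine Or.inr (Or.inr (Or.inr (Or.inr (Or.inr (Or.inr (Or.inr (Or.inr (Or.inr (Or.inl ⟨m, hmb, hc, hp, hzm m rfl (by omega), fun hm => hy1 (by omega) hm⟩)))))))))
  · refine Or.inr (Or.inr (Or.inr (Or.inr (Or.inr (Or.inr (Or.inr (Or.inr (Or.inr (Or.inr (Or.inl ⟨hb, hp, hc, hzle hm, hy1 (by omega) (by omega), hwle hw⟩))))))))))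
  · refine Or.inr (Or.inr (Or.inr (Or.inr (Or.inr (Or.inr (Or.inr (Or.inr (Or.inr (Or.inr (Or.inr (Or.inl ⟨hb, hc, hcb, hzle hm, hy1 (by omega) (by omega), hwm _ hw (by omega)⟩)))))))))))
  · refine Or.inr (Or.inr (Or.inr (Or.inr (Or.inr (Or.inr (Or.inr (Or.inr (Or.inr (Or.inr (Or.inr (Or.inr (Or.inl ⟨hb, hc, hcb, hzm _ hm (by omega), hy1 (by omega) (by omega)⟩))))))))))))
  · refine Or.inr (Or.inr (Or.inr (Or.inr (Or.inr (Or.inr (Or.inr (Or.inr (Or.inr (Or.inr (Or.inr (Or.inr (Or.inr (Or.inl ⟨hb, hc, hcb, hzm _ hm (by omega), hy1 (by omega) (by omega)⟩)))))))))))))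
  · refine Or.inr (Or.inr (Or.inr (Or.inr (Or.inr (Or.inr (Or.inr (Or.inr (Or.inr (Or.inr (Or.inr (Or.inr (Or.inr (Or.inr (Or.inl ⟨hb, hc, hcb, hzm _ hm (by omega), hy1 (by omega) (by omega)⟩))))))))))))))
  · refine Or.inr (Or.inr (Or.inr (Or.inr (Or.inr (Or.inr (Or.inr (Or.inr (Or.inr (Or.inr (Or.inr (Or.inr (Or.inr (Or.inr (Or.inr (Or.inl ⟨m, hm2', hmb, hc, hp, hzm m rfl (by omega), hy1 (by omega) (by omega)⟩)))))))))))))))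
  · refine Or.inr (Or.inr (Or.inr (Or.inr (Or.inr (Or.inr (Or.inr (Or.inr (Or.inr (Or.inr (Or.inr (Or.inr (Or.inr (Or.inr (Or.inr (Or.inr (Or.inl ⟨m, hm1', hmb, hc, hp, hzm m rfl (by omega), hy1 (by omega) (by omega)⟩))))))))))))))))
  · refine Or.inr (Or.inr (Or.inr (Or.inr (Or.inr (Or.inr (Or.inr (Or.inr (Or.inr (Or.inr (Or.inr (Or.inr (Or.inr (Or.inr (Or.inr (Or.inr (Or.inr (Or.inl ⟨m, hm3, hmb, hc, hp, hzm m rfl (by omega), hy1 (by omega) (by omega)⟩)))))))))))))))))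
  · refine Or.inr (Or.inr (Or.inr (Or.inr (Or.inr (Or.inr (Or.inr (Or.inr (Or.inr (Or.inr (Or.inr (Or.inr (Or.inr (Or.inr (Or.inr (Or.inr (Or.inr (Or.inr (Or.inl ⟨hb, hc, hcb, hzm _ hm (by omega), hy1 (by omega) (by omega), hwm _ hw (by omega)⟩))))))))))))))))))
  · refine Or.inr (Or.inr (Or.inr (Or.inr (Or.inr (Or.inr (Or.inr (Or.inr (Or.inr (Or.inr (Or.inr (Or.inr (Or.inr (Or.inr (Or.inr (Or.inr (Or.inr (Or.inr (Or.inr (Or.inl ⟨hb, hc, hcb, hzm _ hm (by omega), hy1 (by omega) (by omega), ?_⟩)))))))))))))))))))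
    rcases hw with ⟨hb1, hcw⟩ | ⟨hb2, hcb', hw⟩
    · exact Or.inl ⟨hb1, hwle hcw⟩
    · exact Or.inr ⟨hb2, hcb', hwm _ hw (by omega)⟩
  · refine Or.inr (Or.inr (Or.inr (Or.inr (Or.inr (Or.inr (Or.inr (Or.inr (Or.inr (Or.inr (Or.inr (Or.inr (Or.inr (Or.inr (Or.inr (Or.inr (Or.inr (Or.inr (Or.inr (Or.inr ⟨hb, hc, hcb, hzm _ hm (by omega), hy1 (by omega) (by omega), ?_⟩)))))))))))))))))))
    rcases hw with ⟨hb1, hcw⟩ | ⟨hb2, hcb', hw⟩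
    · exact Or.inl ⟨hb1, hwle hcw⟩
    · exact Or.inr ⟨hb2, hcb', hwm _ hw (by omega)⟩

end Summit.HodgeConjecture.HodgeConjecture.Cruxes.H413.F0P3cDyRamDiagonalDualisableStrataTypeTwoSieve

end
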